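/- Width seat `ym-line-sfw-p2-w5` (prover-ym-line-sfw-p2-w5-g18-0), free hands for planner ym-idea-2's STUB-PLAN-E (LINE-17 on crux
`AllWindowsColdBox.BoxMidWindowsSU22` = stmt-QuantumFields-24003, stub E `stub_tiltMoments`), piece E(0), chart half, `G`-generic. -/
import Summits.QuantumFields.YangMills.Theorems.AllWindowsColdBoxExpFourCubicTaylor
import Summits.QuantumFields.YangMills.Theorems.ColdBoxAllGroupsBoxFloorAllGroupsTiltBoundG

/-!
# The cubic Taylor polynomial of the plaquette cost in the exponential chart (STUB-PLAN-E, piece E(0), chart half, `G`-generic)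

For a compact group presented by a continuous unitary-valued `ρ : G →* U(N)` and its exponential chart `ψ = expChart ρ` (`ρ(ψ a) = e^{L a}`,
`L = lieIso ρ : ℝ^D → 𝔲(N)` a linear isometry, `D = dimE ρ`), the cost of a plaquette with chart coordinates `aᵢ` (`‖aᵢ‖ ≤ m ≤ 1/4`) is
`N − Re tr ρ(ψa₁ ψa₂ (ψa₃)⁻¹ (ψa₄)⁻¹) = ½‖s‖² − ½·Σ_{i<j} σᵢσⱼ·T_ρ(s, aᵢ, aⱼ) + O(m⁴)` (`s = a₁ + a₂ − a₃ − a₄`, `σ = (+,+,−,−)`, constant `560`;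
matrix half in the sibling file `AllWindowsColdBoxExpFourCubicTaylor`) with the **cubic form of the chart** `T_ρ(a,b,c) = Re tr(L a·(L b·L c − L c·L b))`
(`chartCubic ρ`): trilinear, ALTERNATING (trace cyclicity), `|T_ρ| ≤ 2‖a‖‖b‖‖c‖`.  For `SU(2)` in an oriented orthonormal basis `T = κ₃·det`;
downstream (E(1)–E(3): the cubic chaos `V₃`, its trace-free structure, its Gram variance bound) only «trilinear + alternating + bounded» is used.

* §3 `chartCubic` and its API (`_add/_smul/_sum` in each slot, `_neg`, `_swap₁₂/_swap₂₃`, `_self`, `chartCubic_smul_smul_smul`, `abs_chartCubic_le`,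
  `chartCubic_eq_sum_coord` = coordinate expansion in the basis `EuclideanSpace.single α 1`), **`abs_cost_expChart_holonomy_sub_cubic_le`**
  (`m`-form) and **`abs_cost_expChart_holonomy_sub_cubic_le_sum`** (pointwise form `≤ 560·Σᵢ‖aᵢ‖⁴` under `‖aᵢ‖ ≤ 1/4`).
* §4 (objects of `ColdBoxAllGroupsOneScaleDefs`) **`abs_qObsD_sub_beta_mul_plaqCostAt_sub_cubic_le`**: `β > 0`, all chart coordinates
  `a = extZero (unscaleTE t)` of norm `≤ 1/4` ⇒ for EVERY plaquette `(x,i,j)` with legs `a₁ = a(x,i)`, `a₂ = a(x+eᵢ,j)`, `a₃ = a(x+eⱼ,i)`,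
  `a₄ = a(x,j)`, `s = circV a (x,i,j)`: `|qObsD (x,i,j) t − β·plaqCostAt ρ x i j (cfgTE t) − β·½(T(s,a₁,a₂) − T(s,a₁,a₃) − T(s,a₁,a₄) − T(s,a₂,a₃)`
  `− T(s,a₂,a₄) + T(s,a₃,a₄))| ≤ 560·β·Σₖ‖aₖ‖⁴`; with `a = t/√β` the cubic term is `β^{−1/2}·P₃(t)` and the bound is `560·Σₖ‖t_{eₖ}‖⁴/β` — the
  pointwise polynomial dominator `R₄ ≤ C₄·Q₄/β` of STUB-PLAN-E §1 (sup bounds alone do not suffice at `θ = 1/16`).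
* §5 `tiltCubicW` (the cubic part of the tilt, summed over the plaquettes touching the cold box) and **`abs_tiltWE_sub_tiltCubicW_sub_log_le`**:
  `|tiltWE − tiltCubicW − Σ_e log g(a_e)| ≤ 560·β·Σ_q Σ_legs ‖a_leg‖⁴`.

Everything is proved; two definitions (`chartCubic`, `tiltCubicW`); standard axioms.  HONEST LABEL: helper toward the open registered stub E of a
critic-passed line on the R2ξ″ RECORD-rung crux 24003; no stub is proved by name, no crux, rung or summit is proved; the Yang–Mills mass gap is
NOT proved by this file.
-/

set_option autoImplicit false

noncomputable section

open scoped Matrix Matrix.Norms.Frobenius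
open NormedSpace

namespace Summit.QuantumFields.YangMills.Theorems.ColdBoxAllGroups

/-! ## §3 The cubic form of the exponential chart and the cost in chart coordinates -/

section Chart

open Summit.QuantumFields.YangMills.Theorems.FreeEnergyLogCoefficient

variable {N : ℕ} {G : Type*} [Group G] (ρ : G →* Matrix (Fin N) (Fin N) ℂ)

/-- **The cubic form of the exponential chart** of the representation `ρ`: `T_ρ(a,b,c) = Re tr(L a · (L b · L c − L c · L b))`,
`L = lieIso ρ : ℝ^D → 𝔲(N)` the isometric parametrisation of the Lie algebra (`D = dimE ρ`).  It is the coefficient form of the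
DEGREE-THREE Taylor term of the plaquette cost in the chart: `cost = ½‖s‖² − ½Σ_{i<j}σᵢσⱼT_ρ(s,aᵢ,aⱼ) + O(|a|⁴)`
(`abs_cost_expChart_holonomy_sub_cubic_le`).  Trilinear, alternating, `|T_ρ(a,b,c)| ≤ 2‖a‖‖b‖‖c‖`; for the fundamental representation of
`SU(2)` it is a multiple of the determinant `det[a,b,c]` (sign fixed by the orientation of the chosen orthonormal basis). -/
def chartCubic (a b c : EuclideanSpace ℝ (Fin (dimE ρ))) : ℝ :=
  (lieIso ρ a * (lieIso ρ b * lieIso ρ c - lieIso ρ c * lieIso ρ b)).trace.re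

/-- `chartCubic` unfolded. -/
theorem chartCubic_eq (a b c : EuclideanSpace ℝ (Fin (dimE ρ))) :
    chartCubic ρ a b c = (lieIso ρ a * (lieIso ρ b * lieIso ρ c - lieIso ρ c * lieIso ρ b)).trace.re := rfl

/-- Additivity in the first slot. -/
theorem chartCubic_add_left (a a' b c : EuclideanSpace ℝ (Fin (dimE ρ))) :
    chartCubic ρ (a + a') b c = chartCubic ρ a b c + chartCubic ρ a' b c := by
  simp only [chartCubic, map_add, Matrix.add_mul, Matrix.trace_add, Complex.add_re]

/-- Homogeneity in the first slot. -/
theorem chartCubic_smul_left (r : ℝ) (a b c : EuclideanSpace ℝ (Fin (dimE ρ))) :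
    chartCubic ρ (r • a) b c = r * chartCubic ρ a b c := by
  simp only [chartCubic, LinearIsometry.map_smul, Matrix.smul_mul, Matrix.trace_smul, Complex.smul_re, smul_eq_mul]

/-- Additivity in the second slot. -/
theorem chartCubic_add_mid (a b b' c : EuclideanSpace ℝ (Fin (dimE ρ))) :
    chartCubic ρ a (b + b') c = chartCubic ρ a b c + chartCubic ρ a b' c := by
  simp only [chartCubic, map_add, Matrix.add_mul, Matrix.mul_add, Matrix.trace_add, Matrix.trace_sub, Matrix.mul_sub,
    Complex.add_re, Complex.sub_re]
  ring

/-- Homogeneity in the second slot. -/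
theorem chartCubic_smul_mid (r : ℝ) (a b c : EuclideanSpace ℝ (Fin (dimE ρ))) :
    chartCubic ρ a (r • b) c = r * chartCubic ρ a b c := by
  simp only [chartCubic, LinearIsometry.map_smul, Matrix.smul_mul, Matrix.mul_smul, ← smul_sub, Matrix.trace_smul,
    Complex.smul_re, smul_eq_mul]

/-- Antisymmetry in the last two slots. -/
theorem chartCubic_swap₂₃ (a b c : EuclideanSpace ℝ (Fin (dimE ρ))) : chartCubic ρ a c b = -chartCubic ρ a b c := by
  simp only [chartCubic]
  rw [← neg_sub (lieIso ρ b * lieIso ρ c), Matrix.mul_neg, Matrix.trace_neg, Complex.neg_re]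

/-- Antisymmetry in the first two slots (trace cyclicity). -/
theorem chartCubic_swap₁₂ (a b c : EuclideanSpace ℝ (Fin (dimE ρ))) : chartCubic ρ b a c = -chartCubic ρ a b c := by
  simp only [chartCubic, Matrix.mul_sub, Matrix.trace_sub, Complex.sub_re]
  have h1 : (lieIso ρ b * (lieIso ρ a * lieIso ρ c)).trace = (lieIso ρ a * (lieIso ρ c * lieIso ρ b)).trace := by
    rw [Matrix.trace_mul_cycle', Matrix.trace_mul_cycle']
  have h2 : (lieIso ρ b * (lieIso ρ c * lieIso ρ a)).trace = (lieIso ρ a * (lieIso ρ b * lieIso ρ c)).trace := by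
    rw [Matrix.trace_mul_cycle']
  rw [h1, h2]
  ring

/-- Additivity in the third slot. -/
theorem chartCubic_add_right (a b c c' : EuclideanSpace ℝ (Fin (dimE ρ))) :
    chartCubic ρ a b (c + c') = chartCubic ρ a b c + chartCubic ρ a b c' := by
  rw [chartCubic_swap₂₃, chartCubic_add_mid, chartCubic_swap₂₃ ρ a c b, chartCubic_swap₂₃ ρ a c' b]
  ring

/-- Homogeneity in the third slot. -/
theorem chartCubic_smul_right (r : ℝ) (a b c : EuclideanSpace ℝ (Fin (dimE ρ))) :
    chartCubic ρ a b (r • c) = r * chartCubic ρ a b c := by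
  rw [chartCubic_swap₂₃, chartCubic_smul_mid, chartCubic_swap₂₃ ρ a c b]
  ring

/-- Negation in the second slot. -/
theorem chartCubic_neg_mid (a b c : EuclideanSpace ℝ (Fin (dimE ρ))) : chartCubic ρ a (-b) c = -chartCubic ρ a b c := by
  rw [← neg_one_smul ℝ b, chartCubic_smul_mid]; ring

/-- Negation in the third slot. -/
theorem chartCubic_neg_right (a b c : EuclideanSpace ℝ (Fin (dimE ρ))) : chartCubic ρ a b (-c) = -chartCubic ρ a b c := by
  rw [← neg_one_smul ℝ c, chartCubic_smul_right]; ring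

/-- Joint homogeneity: `T(r•a, r•b, r•c) = r³·T(a,b,c)` (with `r = β^{−1/2}` this turns the cubic term of the chart coordinates `a = t/√β` into
`β^{−3/2}` times the cubic form of the Gaussian variables `t`). -/
theorem chartCubic_smul_smul_smul (r : ℝ) (a b c : EuclideanSpace ℝ (Fin (dimE ρ))) :
    chartCubic ρ (r • a) (r • b) (r • c) = r ^ 3 * chartCubic ρ a b c := by
  rw [chartCubic_smul_left, chartCubic_smul_mid, chartCubic_smul_right]; ring

/-- Alternating: a repeated vector in slots 1, 2 gives `0`. -/
theorem chartCubic_self₁₂ (a c : EuclideanSpace ℝ (Fin (dimE ρ))) : chartCubic ρ a a c = 0 := by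
  have h := chartCubic_swap₁₂ ρ a a c
  linarith

/-- Alternating: a repeated vector in slots 2, 3 gives `0`. -/
theorem chartCubic_self₂₃ (a b : EuclideanSpace ℝ (Fin (dimE ρ))) : chartCubic ρ a b b = 0 := by
  have h := chartCubic_swap₂₃ ρ a b b
  linarith

/-- Alternating: a repeated vector in slots 1, 3 gives `0`. -/
theorem chartCubic_self₁₃ (a b : EuclideanSpace ℝ (Fin (dimE ρ))) : chartCubic ρ a b a = 0 := by
  rw [chartCubic_swap₂₃, chartCubic_self₁₂, neg_zero]

/-- **Boundedness**: `|T_ρ(a,b,c)| ≤ 2‖a‖‖b‖‖c‖` (Cauchy–Schwarz for the Frobenius pairing, submultiplicativity, `‖L a‖ = ‖a‖`). -/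
theorem abs_chartCubic_le (a b c : EuclideanSpace ℝ (Fin (dimE ρ))) : |chartCubic ρ a b c| ≤ 2 * ‖a‖ * ‖b‖ * ‖c‖ := by
  rw [chartCubic_eq]
  refine (abs_re_trace_mul_le _ _).trans ?_
  have hbc : ‖lieIso ρ b * lieIso ρ c - lieIso ρ c * lieIso ρ b‖ ≤ 2 * ‖b‖ * ‖c‖ := by
    refine (norm_sub_le _ _).trans ?_
    have h1 := norm_mul_le (lieIso ρ b) (lieIso ρ c)
    have h2 := norm_mul_le (lieIso ρ c) (lieIso ρ b)
    rw [norm_lieIso, norm_lieIso] at h1 h2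
    linarith
  rw [norm_lieIso]
  calc ‖a‖ * ‖lieIso ρ b * lieIso ρ c - lieIso ρ c * lieIso ρ b‖ ≤ ‖a‖ * (2 * ‖b‖ * ‖c‖) :=
        mul_le_mul_of_nonneg_left hbc (norm_nonneg _)
    _ = 2 * ‖a‖ * ‖b‖ * ‖c‖ := by ring

/-- Finite additivity in the first slot. -/
theorem chartCubic_sum_left {ι : Type*} (s : Finset ι) (f : ι → EuclideanSpace ℝ (Fin (dimE ρ)))
    (b c : EuclideanSpace ℝ (Fin (dimE ρ))) : chartCubic ρ (∑ i ∈ s, f i) b c = ∑ i ∈ s, chartCubic ρ (f i) b c := by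
  classical
  induction s using Finset.induction_on with
  | empty => simp [chartCubic]
  | insert i s hi ih => rw [Finset.sum_insert hi, Finset.sum_insert hi, chartCubic_add_left, ih]

/-- Finite additivity in the second slot. -/
theorem chartCubic_sum_mid {ι : Type*} (s : Finset ι) (f : ι → EuclideanSpace ℝ (Fin (dimE ρ)))
    (a c : EuclideanSpace ℝ (Fin (dimE ρ))) : chartCubic ρ a (∑ i ∈ s, f i) c = ∑ i ∈ s, chartCubic ρ a (f i) c := by
  classical
  induction s using Finset.induction_on with
  | empty => simp [chartCubic]
  | insert i s hi ih => rw [Finset.sum_insert hi, Finset.sum_insert hi, chartCubic_add_mid, ih]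

/-- Finite additivity in the third slot. -/
theorem chartCubic_sum_right {ι : Type*} (s : Finset ι) (f : ι → EuclideanSpace ℝ (Fin (dimE ρ)))
    (a b : EuclideanSpace ℝ (Fin (dimE ρ))) : chartCubic ρ a b (∑ i ∈ s, f i) = ∑ i ∈ s, chartCubic ρ a b (f i) := by
  classical
  induction s using Finset.induction_on with
  | empty => simp [chartCubic]
  | insert i s hi ih => rw [Finset.sum_insert hi, Finset.sum_insert hi, chartCubic_add_right, ih]

/-- **Coordinate expansion**: `T_ρ(a,b,c) = Σ_{α,β,γ} a_α b_β c_γ · T_ρ(e_α,e_β,e_γ)` in the standard basis `e_α = EuclideanSpace.single α 1`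
of the chart; the coefficient tensor `T_ρ(e_α,e_β,e_γ)` is alternating and bounded by `2` (the input of the trace-free cubic chaos of E(2)). -/
theorem chartCubic_eq_sum_coord (a b c : EuclideanSpace ℝ (Fin (dimE ρ))) :
    chartCubic ρ a b c = ∑ α, ∑ β, ∑ γ, a α * b β * c γ *
      chartCubic ρ (EuclideanSpace.single α 1) (EuclideanSpace.single β 1) (EuclideanSpace.single γ 1) := by
  have hexp : ∀ v : EuclideanSpace ℝ (Fin (dimE ρ)), v = ∑ α, v α • EuclideanSpace.single α (1 : ℝ) := fun v => by
    conv_lhs => rw [← (EuclideanSpace.basisFun (Fin (dimE ρ)) ℝ).sum_repr v]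
    simp only [EuclideanSpace.basisFun_repr, EuclideanSpace.basisFun_apply]
  conv_lhs => rw [hexp a, hexp b, hexp c]
  rw [chartCubic_sum_left]
  refine Finset.sum_congr rfl fun α _ => ?_
  rw [chartCubic_smul_left, chartCubic_sum_mid, Finset.mul_sum]
  refine Finset.sum_congr rfl fun β _ => ?_
  rw [chartCubic_smul_mid, chartCubic_sum_right, Finset.mul_sum, Finset.mul_sum]
  refine Finset.sum_congr rfl fun γ _ => ?_
  rw [chartCubic_smul_right]
  ring

/-- The signed commutator sum of the chart matrices `L a₁, L a₂, −L a₃, −L a₄`, paired with `L s`, is the signed sum of cubic forms. -/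
theorem re_trace_lieIso_mul_commutators (s a₁ a₂ a₃ a₄ : EuclideanSpace ℝ (Fin (dimE ρ))) :
    (lieIso ρ s * ((lieIso ρ a₁ * lieIso ρ a₂ - lieIso ρ a₂ * lieIso ρ a₁) - (lieIso ρ a₁ * lieIso ρ a₃ - lieIso ρ a₃ * lieIso ρ a₁) -
        (lieIso ρ a₁ * lieIso ρ a₄ - lieIso ρ a₄ * lieIso ρ a₁) - (lieIso ρ a₂ * lieIso ρ a₃ - lieIso ρ a₃ * lieIso ρ a₂) -
        (lieIso ρ a₂ * lieIso ρ a₄ - lieIso ρ a₄ * lieIso ρ a₂) + (lieIso ρ a₃ * lieIso ρ a₄ - lieIso ρ a₄ * lieIso ρ a₃))).trace.re =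
      chartCubic ρ s a₁ a₂ - chartCubic ρ s a₁ a₃ - chartCubic ρ s a₁ a₄ - chartCubic ρ s a₂ a₃ - chartCubic ρ s a₂ a₄ +
        chartCubic ρ s a₃ a₄ := by
  simp only [chartCubic, Matrix.mul_add, Matrix.mul_sub, Matrix.trace_add, Matrix.trace_sub, Complex.add_re, Complex.sub_re]

/-- For nonnegative reals, the fourth power of the maximum of four is at most the sum of the fourth powers. -/
theorem max_four_pow_four_le {x₁ x₂ x₃ x₄ : ℝ} (h₁ : 0 ≤ x₁) (h₂ : 0 ≤ x₂) (h₃ : 0 ≤ x₃) (h₄ : 0 ≤ x₄) :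
    (max (max x₁ x₂) (max x₃ x₄)) ^ 4 ≤ x₁ ^ 4 + x₂ ^ 4 + x₃ ^ 4 + x₄ ^ 4 := by
  have p₁ := pow_nonneg h₁ 4; have p₂ := pow_nonneg h₂ 4; have p₃ := pow_nonneg h₃ 4; have p₄ := pow_nonneg h₄ 4
  rcases max_choice (max x₁ x₂) (max x₃ x₄) with h | h <;> rw [h]
  · rcases max_choice x₁ x₂ with h' | h' <;> rw [h'] <;> linarith
  · rcases max_choice x₃ x₄ with h' | h' <;> rw [h'] <;> linarith

variable [TopologicalSpace G] [CompactSpace G]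

/-- **The cubic Taylor polynomial of the plaquette cost in the exponential chart.**  For a continuous unitary-valued `ρ : G →* U(N)` and chart
coordinates `a₁, a₂, a₃, a₄ ∈ ℝ^D` with `‖aᵢ‖ ≤ m ≤ 1/4`, the links `gᵢ = expChart ρ aᵢ` and the linear circulation `s = a₁ + a₂ − a₃ − a₄` satisfy
`|(N − Re tr ρ(g₁ g₂ g₃⁻¹ g₄⁻¹)) − ½‖s‖² + ½(T(s,a₁,a₂) − T(s,a₁,a₃) − T(s,a₁,a₄) − T(s,a₂,a₃) − T(s,a₂,a₄) + T(s,a₃,a₄))| ≤ 560·m⁴`,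
`T = chartCubic ρ`. -/
theorem abs_cost_expChart_holonomy_sub_cubic_le (hρ : Continuous ρ) (a₁ a₂ a₃ a₄ : EuclideanSpace ℝ (Fin (dimE ρ))) {m : ℝ}
    (hm : m ≤ 1 / 4) (h₁ : ‖a₁‖ ≤ m) (h₂ : ‖a₂‖ ≤ m) (h₃ : ‖a₃‖ ≤ m) (h₄ : ‖a₄‖ ≤ m) :
    |((N : ℝ) - (ρ (expChart ρ a₁ * expChart ρ a₂ * (expChart ρ a₃)⁻¹ * (expChart ρ a₄)⁻¹)).trace.re) -
        ‖a₁ + a₂ - a₃ - a₄‖ ^ 2 / 2 +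
        (chartCubic ρ (a₁ + a₂ - a₃ - a₄) a₁ a₂ - chartCubic ρ (a₁ + a₂ - a₃ - a₄) a₁ a₃ -
          chartCubic ρ (a₁ + a₂ - a₃ - a₄) a₁ a₄ - chartCubic ρ (a₁ + a₂ - a₃ - a₄) a₂ a₃ -
          chartCubic ρ (a₁ + a₂ - a₃ - a₄) a₂ a₄ + chartCubic ρ (a₁ + a₂ - a₃ - a₄) a₃ a₄) / 2| ≤ 560 * m ^ 4 := by
  rw [map_mul, map_mul, map_mul, rho_expChart_inv ρ hρ, rho_expChart_inv ρ hρ, rho_expChart ρ hρ, rho_expChart ρ hρ,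
    ← inv_exp_eq_exp_neg, ← inv_exp_eq_exp_neg]
  have hn : ‖a₁ + a₂ - a₃ - a₄‖ = ‖lieIso ρ a₁ + lieIso ρ a₂ - lieIso ρ a₃ - lieIso ρ a₄‖ := by
    rw [← map_add, ← map_sub, ← map_sub, norm_lieIso]
  have hs : lieIso ρ (a₁ + a₂ - a₃ - a₄) = lieIso ρ a₁ + lieIso ρ a₂ - lieIso ρ a₃ - lieIso ρ a₄ := by
    rw [map_sub, map_sub, map_add]
  rw [hn, ← re_trace_lieIso_mul_commutators, hs]
  exact abs_cost_exp_holonomy_sub_cubic_le (conjTranspose_lieIso ρ a₁) (conjTranspose_lieIso ρ a₂) (conjTranspose_lieIso ρ a₃)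
    (conjTranspose_lieIso ρ a₄) hm (by rw [norm_lieIso]; exact h₁) (by rw [norm_lieIso]; exact h₂) (by rw [norm_lieIso]; exact h₃)
    (by rw [norm_lieIso]; exact h₄)

/-- **Pointwise (polynomial) form of the quartic remainder**: if every `‖aᵢ‖ ≤ 1/4` then the remainder of
`abs_cost_expChart_holonomy_sub_cubic_le` is at most `560·(‖a₁‖⁴ + ‖a₂‖⁴ + ‖a₃‖⁴ + ‖a₄‖⁴)` (take `m = maxᵢ ‖aᵢ‖`). -/
theorem abs_cost_expChart_holonomy_sub_cubic_le_sum (hρ : Continuous ρ) (a₁ a₂ a₃ a₄ : EuclideanSpace ℝ (Fin (dimE ρ)))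
    (h₁ : ‖a₁‖ ≤ 1 / 4) (h₂ : ‖a₂‖ ≤ 1 / 4) (h₃ : ‖a₃‖ ≤ 1 / 4) (h₄ : ‖a₄‖ ≤ 1 / 4) :
    |((N : ℝ) - (ρ (expChart ρ a₁ * expChart ρ a₂ * (expChart ρ a₃)⁻¹ * (expChart ρ a₄)⁻¹)).trace.re) -
        ‖a₁ + a₂ - a₃ - a₄‖ ^ 2 / 2 +
        (chartCubic ρ (a₁ + a₂ - a₃ - a₄) a₁ a₂ - chartCubic ρ (a₁ + a₂ - a₃ - a₄) a₁ a₃ -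
          chartCubic ρ (a₁ + a₂ - a₃ - a₄) a₁ a₄ - chartCubic ρ (a₁ + a₂ - a₃ - a₄) a₂ a₃ -
          chartCubic ρ (a₁ + a₂ - a₃ - a₄) a₂ a₄ + chartCubic ρ (a₁ + a₂ - a₃ - a₄) a₃ a₄) / 2| ≤
      560 * (‖a₁‖ ^ 4 + ‖a₂‖ ^ 4 + ‖a₃‖ ^ 4 + ‖a₄‖ ^ 4) := by
  set m := max (max ‖a₁‖ ‖a₂‖) (max ‖a₃‖ ‖a₄‖) with hm
  have hmle : m ≤ 1 / 4 := max_le (max_le h₁ h₂) (max_le h₃ h₄)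
  have hm₁ : ‖a₁‖ ≤ m := (le_max_left _ _).trans (le_max_left _ _)
  have hm₂ : ‖a₂‖ ≤ m := (le_max_right _ _).trans (le_max_left _ _)
  have hm₃ : ‖a₃‖ ≤ m := (le_max_left _ _).trans (le_max_right _ _)
  have hm₄ : ‖a₄‖ ≤ m := (le_max_right _ _).trans (le_max_right _ _)
  refine (abs_cost_expChart_holonomy_sub_cubic_le ρ hρ a₁ a₂ a₃ a₄ hmle hm₁ hm₂ hm₃ hm₄).trans ?_
  exact mul_le_mul_of_nonneg_left (max_four_pow_four_le (norm_nonneg _) (norm_nonneg _) (norm_nonneg _) (norm_nonneg _))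
    (by norm_num)

end Chart

/-! ## §4 The cubic term per plaquette in the variables of the one-scale expansion -/

section Line

open MeasureTheory Finset
open Literature.Probability.LatticeModels (Site)
open Literature.MathematicalPhysics.QuantumLattice
open Literature.MathematicalPhysics.QuantumFieldTheory
open Literature.MathematicalPhysics.QuantumFieldTheory.LatticeMaxwell
open Literature.MathematicalPhysics.QuantumFieldTheory.AxialGauge
open Summit.QuantumFields.YangMills.Theorems.WeakCouplingRates
open Summit.QuantumFields.YangMills.Theorems.FreeEnergyLogCoefficient

variable {N : ℕ} {G : Type*} [Group G] (ρ : G →* Matrix (Fin N) (Fin N) ℂ) {H : ℕ}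
variable [TopologicalSpace G] [CompactSpace G]

/-- **The cubic term per plaquette, in the colour variables.**  For a continuous unitary-valued `ρ`, `β > 0` and a colour tuple `t` all of whose
chart coordinates `a = extZero (unscaleTE H D β t)` have norm `≤ 1/4` (`D = dimE ρ`): for EVERY plaquette `(x, i, j)` of `ℤ⁴`, with legs
`a₁ = a(x,i)`, `a₂ = a(x+eᵢ,j)`, `a₃ = a(x+eⱼ,i)`, `a₄ = a(x,j)` and linear circulation `s = circV a (x,i,j) = a₁ + a₂ − a₃ − a₄`,
`|qObsD (x,i,j) t − β·plaqCostAt ρ x i j (cfgTE ρ H β t) − β·½(T(s,a₁,a₂) − T(s,a₁,a₃) − T(s,a₁,a₄) − T(s,a₂,a₃) − T(s,a₂,a₄) + T(s,a₃,a₄))|`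
`≤ 560·β·(‖a₁‖⁴ + ‖a₂‖⁴ + ‖a₃‖⁴ + ‖a₄‖⁴)` (`T = chartCubic ρ`).  Reading: `qObsD − β·cost = β^{−1/2}·P₃(t) − R₄(t)` with
`|R₄| ≤ 560·Σₖ‖t_{eₖ}‖⁴/β` after `a = t/√β` and `chartCubic_smul_smul_smul`. -/
theorem abs_qObsD_sub_beta_mul_plaqCostAt_sub_cubic_le (hρ : Continuous ρ) {β : ℝ} (hβ : 0 < β) (t : TSpaceD H (dimE ρ))
    (ht : ∀ e, ‖unscaleTE H (dimE ρ) β t e‖ ≤ 1 / 4) (x : Site 4) (i j : Fin 4) :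
    |qObsD H (dimE ρ) (x, i, j) t - β * plaqCostAt ρ x i j (cfgTE ρ H β t) -
        β * ((chartCubic ρ (circV (extZero (unscaleTE H (dimE ρ) β t)) (x, i, j))
              (extZero (unscaleTE H (dimE ρ) β t) (x, i)) (extZero (unscaleTE H (dimE ρ) β t) (x + Pi.single i 1, j)) -
            chartCubic ρ (circV (extZero (unscaleTE H (dimE ρ) β t)) (x, i, j))
              (extZero (unscaleTE H (dimE ρ) β t) (x, i)) (extZero (unscaleTE H (dimE ρ) β t) (x + Pi.single j 1, i)) -
            chartCubic ρ (circV (extZero (unscaleTE H (dimE ρ) β t)) (x, i, j))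
              (extZero (unscaleTE H (dimE ρ) β t) (x, i)) (extZero (unscaleTE H (dimE ρ) β t) (x, j)) -
            chartCubic ρ (circV (extZero (unscaleTE H (dimE ρ) β t)) (x, i, j))
              (extZero (unscaleTE H (dimE ρ) β t) (x + Pi.single i 1, j)) (extZero (unscaleTE H (dimE ρ) β t) (x + Pi.single j 1, i)) -
            chartCubic ρ (circV (extZero (unscaleTE H (dimE ρ) β t)) (x, i, j))
              (extZero (unscaleTE H (dimE ρ) β t) (x + Pi.single i 1, j)) (extZero (unscaleTE H (dimE ρ) β t) (x, j)) +
            chartCubic ρ (circV (extZero (unscaleTE H (dimE ρ) β t)) (x, i, j))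
              (extZero (unscaleTE H (dimE ρ) β t) (x + Pi.single j 1, i)) (extZero (unscaleTE H (dimE ρ) β t) (x, j))) / 2)| ≤
      560 * β * (‖extZero (unscaleTE H (dimE ρ) β t) (x, i)‖ ^ 4 + ‖extZero (unscaleTE H (dimE ρ) β t) (x + Pi.single i 1, j)‖ ^ 4 +
        ‖extZero (unscaleTE H (dimE ρ) β t) (x + Pi.single j 1, i)‖ ^ 4 + ‖extZero (unscaleTE H (dimE ρ) β t) (x, j)‖ ^ 4) := by
  have hn : ∀ e, ‖extZero (unscaleTE H (dimE ρ) β t) e‖ ≤ 1 / 4 := norm_extZero_le (by norm_num) ht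
  have hcub := abs_cost_expChart_holonomy_sub_cubic_le_sum ρ hρ (extZero (unscaleTE H (dimE ρ) β t) (x, i))
    (extZero (unscaleTE H (dimE ρ) β t) (x + Pi.single i 1, j)) (extZero (unscaleTE H (dimE ρ) β t) (x + Pi.single j 1, i))
    (extZero (unscaleTE H (dimE ρ) β t) (x, j)) (hn _) (hn _) (hn _) (hn _)
  rw [norm_sq_circ_extZero_unscaleTE hβ t x i j] at hcub
  rw [plaqCostAt_cfgTE_eq]
  simp only [circV]
  set a := extZero (unscaleTE H (dimE ρ) β t) with ha
  set c := ((N : ℝ) - (ρ (expChart ρ (a (x, i)) * expChart ρ (a (x + Pi.single i 1, j)) *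
    (expChart ρ (a (x + Pi.single j 1, i)))⁻¹ * (expChart ρ (a (x, j)))⁻¹)).trace.re) with hc
  set T := chartCubic ρ (a (x, i) + a (x + Pi.single i 1, j) - a (x + Pi.single j 1, i) - a (x, j)) (a (x, i))
      (a (x + Pi.single i 1, j)) -
    chartCubic ρ (a (x, i) + a (x + Pi.single i 1, j) - a (x + Pi.single j 1, i) - a (x, j)) (a (x, i))
      (a (x + Pi.single j 1, i)) -
    chartCubic ρ (a (x, i) + a (x + Pi.single i 1, j) - a (x + Pi.single j 1, i) - a (x, j)) (a (x, i)) (a (x, j)) -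
    chartCubic ρ (a (x, i) + a (x + Pi.single i 1, j) - a (x + Pi.single j 1, i) - a (x, j)) (a (x + Pi.single i 1, j))
      (a (x + Pi.single j 1, i)) -
    chartCubic ρ (a (x, i) + a (x + Pi.single i 1, j) - a (x + Pi.single j 1, i) - a (x, j)) (a (x + Pi.single i 1, j))
      (a (x, j)) +
    chartCubic ρ (a (x, i) + a (x + Pi.single i 1, j) - a (x + Pi.single j 1, i) - a (x, j)) (a (x + Pi.single j 1, i))
      (a (x, j)) with hT
  have e : qObsD H (dimE ρ) (x, i, j) t - β * c - β * (T / 2) = -(β * (c - 2 * qObsD H (dimE ρ) (x, i, j) t / β / 2 + T / 2)) := by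
    field_simp
    ring
  rw [e, abs_neg, abs_mul, abs_of_pos hβ]
  calc β * |c - 2 * qObsD H (dimE ρ) (x, i, j) t / β / 2 + T / 2|
      ≤ β * (560 * (‖a (x, i)‖ ^ 4 + ‖a (x + Pi.single i 1, j)‖ ^ 4 + ‖a (x + Pi.single j 1, i)‖ ^ 4 + ‖a (x, j)‖ ^ 4)) :=
        mul_le_mul_of_nonneg_left hcub hβ.le
    _ = _ := by ring

/-! ## §5 The cubic part of the tilt, summed over the plaquettes touching the cold box -/

variable (H) in
/-- **The cubic part of the tilt** of the one-scale expansion in the exponential chart: the sum over the plaquettes `q` touching the cold box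
`Λ = boxEdges 4 (2H+1)` of `β·½(T(s,a₁,a₂) − T(s,a₁,a₃) − T(s,a₁,a₄) − T(s,a₂,a₃) − T(s,a₂,a₄) + T(s,a₃,a₄))`, `T = chartCubic ρ`, where
`a = extZero (unscaleTE H D β t)` are the chart coordinates, `a₁..a₄` the four legs of `q` in path order (`plaquetteEdges`) and `s = circV a q`
the linear circulation.  After `a = t/√β` (`chartCubic_smul_smul_smul`) this is `β^{−1/2}·V₃(t)` with `V₃` a cubic form in the Gaussian
variables (STUB-PLAN-E §1: `tiltWE = V₃ − ΣR₄ + Σ log J`). -/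
def tiltCubicW (β : ℝ) (t : TSpaceD H (dimE ρ)) : ℝ :=
  ∑ q ∈ plaquettesTouching (boxEdges 4 (2 * H + 1)),
    β * ((chartCubic ρ (circV (extZero (unscaleTE H (dimE ρ) β t)) (q.1, q.2.1.1, q.2.1.2))
          (extZero (unscaleTE H (dimE ρ) β t) (q.1, q.2.1.1))
          (extZero (unscaleTE H (dimE ρ) β t) (q.1 + Pi.single q.2.1.1 1, q.2.1.2)) -
        chartCubic ρ (circV (extZero (unscaleTE H (dimE ρ) β t)) (q.1, q.2.1.1, q.2.1.2))
          (extZero (unscaleTE H (dimE ρ) β t) (q.1, q.2.1.1))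
          (extZero (unscaleTE H (dimE ρ) β t) (q.1 + Pi.single q.2.1.2 1, q.2.1.1)) -
        chartCubic ρ (circV (extZero (unscaleTE H (dimE ρ) β t)) (q.1, q.2.1.1, q.2.1.2))
          (extZero (unscaleTE H (dimE ρ) β t) (q.1, q.2.1.1)) (extZero (unscaleTE H (dimE ρ) β t) (q.1, q.2.1.2)) -
        chartCubic ρ (circV (extZero (unscaleTE H (dimE ρ) β t)) (q.1, q.2.1.1, q.2.1.2))
          (extZero (unscaleTE H (dimE ρ) β t) (q.1 + Pi.single q.2.1.1 1, q.2.1.2))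
          (extZero (unscaleTE H (dimE ρ) β t) (q.1 + Pi.single q.2.1.2 1, q.2.1.1)) -
        chartCubic ρ (circV (extZero (unscaleTE H (dimE ρ) β t)) (q.1, q.2.1.1, q.2.1.2))
          (extZero (unscaleTE H (dimE ρ) β t) (q.1 + Pi.single q.2.1.1 1, q.2.1.2))
          (extZero (unscaleTE H (dimE ρ) β t) (q.1, q.2.1.2)) +
        chartCubic ρ (circV (extZero (unscaleTE H (dimE ρ) β t)) (q.1, q.2.1.1, q.2.1.2))
          (extZero (unscaleTE H (dimE ρ) β t) (q.1 + Pi.single q.2.1.2 1, q.2.1.1))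
          (extZero (unscaleTE H (dimE ρ) β t) (q.1, q.2.1.2))) / 2)

/-- **The tilt is its cubic part plus the chart-density logarithms up to the quartic dominator.**  For a continuous unitary-valued `ρ`, `β > 0`,
any chart density `g` and a colour tuple `t` all of whose chart coordinates have norm `≤ 1/4`:
`|tiltWE ρ H g β t − tiltCubicW ρ H β t − Σ_e log g(a_e)| ≤ 560·β·Σ_{q touching Λ} (‖a₁(q)‖⁴ + ‖a₂(q)‖⁴ + ‖a₃(q)‖⁴ + ‖a₄(q)‖⁴)`
(the per-plaquette `abs_qObsD_sub_beta_mul_plaqCostAt_sub_cubic_le`, summed).  In the Gaussian variables the right-hand side is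
`560·Σ_q Σ_legs ‖t_leg‖⁴/β`, a nonnegative polynomial of degree four divided by `β`. -/
theorem abs_tiltWE_sub_tiltCubicW_sub_log_le (hρ : Continuous ρ) {β : ℝ} (hβ : 0 < β) (g : EuclideanSpace ℝ (Fin (dimE ρ)) → ℝ)
    (t : TSpaceD H (dimE ρ)) (ht : ∀ e, ‖unscaleTE H (dimE ρ) β t e‖ ≤ 1 / 4) :
    |tiltWE ρ H g β t - tiltCubicW ρ H β t - ∑ e : ColdFreeIdx H, Real.log (g (unscaleTE H (dimE ρ) β t e))| ≤
      560 * β * ∑ q ∈ plaquettesTouching (boxEdges 4 (2 * H + 1)),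
        (‖extZero (unscaleTE H (dimE ρ) β t) (q.1, q.2.1.1)‖ ^ 4 +
          ‖extZero (unscaleTE H (dimE ρ) β t) (q.1 + Pi.single q.2.1.1 1, q.2.1.2)‖ ^ 4 +
          ‖extZero (unscaleTE H (dimE ρ) β t) (q.1 + Pi.single q.2.1.2 1, q.2.1.1)‖ ^ 4 +
          ‖extZero (unscaleTE H (dimE ρ) β t) (q.1, q.2.1.2)‖ ^ 4) := by
  have hq := fun q : ZdPlaquette 4 => abs_qObsD_sub_beta_mul_plaqCostAt_sub_cubic_le ρ hρ hβ t ht q.1 q.2.1.1 q.2.1.2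
  have e : tiltWE ρ H g β t - tiltCubicW ρ H β t - ∑ e : ColdFreeIdx H, Real.log (g (unscaleTE H (dimE ρ) β t e)) =
      ∑ q ∈ plaquettesTouching (boxEdges 4 (2 * H + 1)),
        (qObsD H (dimE ρ) (q.1, q.2.1.1, q.2.1.2) t - β * plaqCostAt ρ q.1 q.2.1.1 q.2.1.2 (cfgTE ρ H β t) -
          β * ((chartCubic ρ (circV (extZero (unscaleTE H (dimE ρ) β t)) (q.1, q.2.1.1, q.2.1.2))
                (extZero (unscaleTE H (dimE ρ) β t) (q.1, q.2.1.1))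
                (extZero (unscaleTE H (dimE ρ) β t) (q.1 + Pi.single q.2.1.1 1, q.2.1.2)) -
              chartCubic ρ (circV (extZero (unscaleTE H (dimE ρ) β t)) (q.1, q.2.1.1, q.2.1.2))
                (extZero (unscaleTE H (dimE ρ) β t) (q.1, q.2.1.1))
                (extZero (unscaleTE H (dimE ρ) β t) (q.1 + Pi.single q.2.1.2 1, q.2.1.1)) -
              chartCubic ρ (circV (extZero (unscaleTE H (dimE ρ) β t)) (q.1, q.2.1.1, q.2.1.2))
                (extZero (unscaleTE H (dimE ρ) β t) (q.1, q.2.1.1)) (extZero (unscaleTE H (dimE ρ) β t) (q.1, q.2.1.2)) -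
              chartCubic ρ (circV (extZero (unscaleTE H (dimE ρ) β t)) (q.1, q.2.1.1, q.2.1.2))
                (extZero (unscaleTE H (dimE ρ) β t) (q.1 + Pi.single q.2.1.1 1, q.2.1.2))
                (extZero (unscaleTE H (dimE ρ) β t) (q.1 + Pi.single q.2.1.2 1, q.2.1.1)) -
              chartCubic ρ (circV (extZero (unscaleTE H (dimE ρ) β t)) (q.1, q.2.1.1, q.2.1.2))
                (extZero (unscaleTE H (dimE ρ) β t) (q.1 + Pi.single q.2.1.1 1, q.2.1.2))
                (extZero (unscaleTE H (dimE ρ) β t) (q.1, q.2.1.2)) +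
              chartCubic ρ (circV (extZero (unscaleTE H (dimE ρ) β t)) (q.1, q.2.1.1, q.2.1.2))
                (extZero (unscaleTE H (dimE ρ) β t) (q.1 + Pi.single q.2.1.2 1, q.2.1.1))
                (extZero (unscaleTE H (dimE ρ) β t) (q.1, q.2.1.2))) / 2)) := by
    simp only [tiltWE, tiltCubicW, Finset.sum_sub_distrib]
    ring
  rw [e, Finset.mul_sum]
  exact (Finset.abs_sum_le_sum_abs _ _).trans (Finset.sum_le_sum fun q _ => hq q)

end Line

end Summit.QuantumFields.YangMills.Theorems.ColdBoxAllGroups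

end
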